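/-
Copyright (c) 2026. All rights reserved.
Released under Apache 2.0 license as described in the file LICENSE.
Authors: abc-iut cell, fact-proving seat abc-iut-f-074 (block F, tranche 74; FACT-LIST rows F-0326 /
F-0333 of abc-iut-L4-t9's `BiAnabelianTelecore.lean`, instance forms).
-/
import Literature.AnabelianGeometry.AbsoluteAnabelian.AbsTopIII.BiAnabelianTelecoreSchemaNegative
import Literature.AnabelianGeometry.AbsoluteAnabelian.AbsTopIII.BiAnabelianModelOfType
import HarnessLib

/-!
# [AbsTopIII] Corollary 3.7 (iv) at the sub-models of the model of MLF-Galois pairs: the exact range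
# of the instance forms of `TelecoreIncompatibleStmt` (F-0333) and `Cor_3_7_iv` (F-0326)

S. Mochizuki, *Topics in absolute anabelian geometry III* [MochizukiAbsTopIII2015] (kurims manuscript
`paper:url-5493eb38cbb7`), Cor 3.7 (iv) p. 88 ("[...] are not simultaneously compatible"), proof p. 88
"entirely similar" to Cor 3.6 (iv) pp. 81–82, resting on Lemma 3.4 p. 74 (`α^pf((𝒪^▷_k̄)^pf) ⊄ (𝒪^×_k̄)^pf`).

PROOF-ONLY companion (no notion declared) of `BiAnabelianTelecore.lean` (abc-iut-L4-t9) and of this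
seat's `BiAnabelianTelecoreSchemaNegative.lean` (the universal closures of F-0326 / F-0333 are false).
Here the INSTANCE forms are pinned down exactly, for the `P`-sub-models
`(TFModel.modelSetting p).restrict P` of abc-iut-L4-t9's model of MLF-Galois `TF`-pairs on `ℚ̄_p`
(print: `P` = "of strictly Belyi type"; the tree has no étale `π₁`, so `P` stays an arbitrary object
property):

* `TFModel.model_of_telecoreIncompatibleStmt`, `TFModel.model_of_cor_3_7_iv` — **Cor 3.7 (iv) holds at
  EVERY `P`-sub-model containing an object, for EVERY bi-anabelian lift datum `θ^bi`**, with no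
  slimness and no fullness hypothesis (Lemma 3.4 at a `P`-object, `TFModel.model_of_logKernelObstruction`,
  fed into abc-iut-L4-t9's every-setting reductions; gen 4's `TFModel.model_of_cor_3_7` carried a
  slimness hypothesis only because it bundles item (v));
* `BiAnabelianSetting.not_telecoreIncompatibleStmt_of_isEmpty` — conversely, at ANY setting whose
  `𝒳` has no object the typed second incompatibility FAILS (the family of strict commutations on `𝒟*`
  then contains every pinned homotopy, all pinned pairs having equal path functors out of empty
  categories), for every lift datum; likewise `not_cor_3_7_iv_of_isEmpty`;
* hence the EXACT characterisations `TFModel.model_forall_telecoreIncompatibleStmt_iff` and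
  `TFModel.model_forall_cor_3_7_iv_iff`: Cor 3.7 (iv) [resp. its second incompatibility] holds at the
  `P`-sub-model for all lift data **iff `P` has an object** (a lift datum over the empty sub-model
  exists, `TFModel.nonempty_biAnabelianLift_of_forall_not`, so the failure is not vacuous).

HONEST FRAMING: statements about OUR typed predicates and OUR model; the non-emptiness clause is a
typing boundary (print's `𝒞^{MLF-sB}_{T𝔽}` is non-empty), not a claim about print.  Refereed pre-IUT
anabelian geometry; nothing here bears on [IUTchIII] Cor. 3.12; no side taken.
-/

set_option autoImplicit false

noncomputable section

open CategoryTheory Quiver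

namespace Literature.AnabelianGeometry.AbsoluteAnabelian.AbsTopIII

universe u

/-! ## Every setting with empty `𝒳`: the second incompatibility fails -/

namespace BiAnabelianSetting

open DiagramOfCategories

variable {X E N : Type u} [Category.{u} X] [Category.{u} E] [Category.{u} N]
  (𝔖 : BiAnabelianSetting X E N)

/-- Two functors out of a category without objects are equal. [folklore] -/
private theorem functor_eq_of_isEmpty {C : Type*} [Category C] {D : Type*} [Category D] (hC : IsEmpty C)
    (F G : C ⥤ D) : F = G :=
  CategoryTheory.Functor.ext (fun c => hC.elim c) (fun c => hC.elim c)

/-- **At a setting whose `𝒳` has no object, `TelecoreIncompatibleStmt θ` FAILS for every lift datum**: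
every pinned pair of Cor 3.7 (iv) (`ℋ_δ`-generators, telecore homotopy, `𝔖†_log` homotopies) consists
of paths out of a vertex carrying `𝒳` or `𝒳 ×_𝔈 𝒳`, both empty, so the two path functors coincide and
the family of strict commutations on `𝒟*` contains all of them (their component conditions being
vacuous). [cite: MochizukiAbsTopIII2015, Cor 3.7 (iv) p.88] -/
theorem not_telecoreIncompatibleStmt_of_isEmpty [hX : IsEmpty X] (θ : FiberSquare.BiAnabelianLift 𝔖.gal) :
    ¬ 𝔖.TelecoreIncompatibleStmt θ := by
  obtain ⟨K, hE, -⟩ := 𝔖.starDiagram.exists_homotopyFamily_strict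
  haveI hSq : IsEmpty 𝔖.Sq := ⟨fun o => hX.elim o.fst⟩
  have hR : IsEmpty (𝔖.starDiagram.obj Cor37Vertex.ref) := hX
  have hB : IsEmpty (𝔖.starDiagram.obj Cor37Vertex.box) := hX
  have hF : ∀ n : ℤ, IsEmpty (𝔖.starDiagram.obj (Cor37Vertex.first n)) := fun _ => hSq
  have mem : ∀ {a b : Cor37Vertex} (p q : Path a b), IsEmpty (𝔖.starDiagram.obj a) → K.E p q :=
    fun p q h => (hE p q).2 (functor_eq_of_isEmpty h _ _)
  intro h
  exact h ⟨K,
    ⟨fun n => ⟨mem _ _ hR, fun x => hX.elim x⟩, fun n => ⟨mem _ _ (hF n), fun o => hSq.elim o⟩⟩,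
    fun n => ⟨mem _ _ hR, fun x => hX.elim x⟩,
    ⟨⟨mem _ _ hB, fun x => hX.elim x⟩, fun n => ⟨mem _ _ (hF (n + 1)), fun o => hSq.elim o⟩⟩⟩

/-- Hence `Cor_3_7_iv θ` fails at every setting with empty `𝒳`, for every lift datum.
[cite: MochizukiAbsTopIII2015, Cor 3.7 (iv) p.88] -/
theorem not_cor_3_7_iv_of_isEmpty [IsEmpty X] (θ : FiberSquare.BiAnabelianLift 𝔖.gal) :
    ¬ 𝔖.Cor_3_7_iv θ :=
  fun h => 𝔖.not_telecoreIncompatibleStmt_of_isEmpty θ h.2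

end BiAnabelianSetting

/-! ## The `P`-sub-models of the model of MLF-Galois pairs on `ℚ̄_p` -/

namespace TFModel

variable (p : ℕ) [hp : Fact p.Prime] (P : ObjectProperty (TFModel p))

/-- **[AbsTopIII] Cor 3.7 (iv), second incompatibility, at EVERY `P`-sub-model with an object, for
EVERY lift datum `θ^bi`** (FACT-LIST F-0333 at its named instances): Lemma 3.4 at the `P`-object `x₀`
(`model_of_logKernelObstruction`) fed into abc-iut-L4-t9's `telecoreIncompatibleStmt_of_obstruction`.
No slimness, no fullness of `(Π ↷ M) ↦ Π` is used. [cite: MochizukiAbsTopIII2015, Cor 3.7 (iv) p.88] -/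
theorem model_of_telecoreIncompatibleStmt (x₀ : TFModel p) (hx₀ : P x₀)
    (θ : FiberSquare.BiAnabelianLift ((modelSetting p).restrict P fun _ h => h).gal) :
    Literature.AnabelianGeometry.AbsoluteAnabelian.AbsTopIII.BiAnabelianSetting.TelecoreIncompatibleStmt
      ((modelSetting p).restrict P fun _ h => h) θ :=
  ((modelSetting p).restrict P fun _ h => h).telecoreIncompatibleStmt_of_obstruction θ
    (model_of_logKernelObstruction p P x₀ hx₀)

/-- **[AbsTopIII] Cor 3.7 (iv) (both incompatibilities) at EVERY `P`-sub-model with an object, for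
EVERY lift datum** (FACT-LIST F-0326 at its named instances; gen 4's `model_of_cor_3_7` without the
slimness hypothesis, which served item (v) only). [cite: MochizukiAbsTopIII2015, Cor 3.7 (iv) p.88] -/
theorem model_of_cor_3_7_iv (x₀ : TFModel p) (hx₀ : P x₀)
    (θ : FiberSquare.BiAnabelianLift ((modelSetting p).restrict P fun _ h => h).gal) :
    Literature.AnabelianGeometry.AbsoluteAnabelian.AbsTopIII.BiAnabelianSetting.Cor_3_7_iv
      ((modelSetting p).restrict P fun _ h => h) θ :=
  ((modelSetting p).restrict P fun _ h => h).cor_3_7_iv_of_obstruction θ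
    (model_of_logKernelObstruction p P x₀ hx₀)

/-- The object hypothesis is NECESSARY: at a `P`-sub-model WITHOUT objects the second
incompatibility fails for every lift datum (`not_telecoreIncompatibleStmt_of_isEmpty`).
[cite: MochizukiAbsTopIII2015, Cor 3.7 (iv) p.88] -/
theorem not_model_telecoreIncompatibleStmt_of_forall_not (hP : ∀ A : TFModel p, ¬ P A)
    (θ : FiberSquare.BiAnabelianLift ((modelSetting p).restrict P fun _ h => h).gal) :
    ¬ Literature.AnabelianGeometry.AbsoluteAnabelian.AbsTopIII.BiAnabelianSetting.TelecoreIncompatibleStmt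
      ((modelSetting p).restrict P fun _ h => h) θ :=
  haveI : IsEmpty P.FullSubcategory := ⟨fun A => hP A.obj A.property⟩
  ((modelSetting p).restrict P fun _ h => h).not_telecoreIncompatibleStmt_of_isEmpty θ

/-- Over the empty `P`-sub-model a bi-anabelian lift datum exists (vacuously natural), so the failure
above is not a statement about an empty type of lift data. [cite: MochizukiAbsTopIII2015, Cor 3.7 (ii) p.87] -/
theorem nonempty_biAnabelianLift_of_forall_not (hP : ∀ A : TFModel p, ¬ P A) :
    Nonempty (FiberSquare.BiAnabelianLift ((modelSetting p).restrict P fun _ h => h).gal) :=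
  ⟨{ θbi := NatIso.ofComponents (fun o => (hP o.fst.obj o.fst.property).elim)
        (fun {o} _ _ => (hP o.fst.obj o.fst.property).elim)
     map_θbi := fun o => (hP o.fst.obj o.fst.property).elim }⟩

/-- **Exact range of F-0333's instance forms at the sub-models of the model**: the typed second
incompatibility of Cor 3.7 (iv) holds at the `P`-sub-model for all lift data IFF `P` has an object.
[cite: MochizukiAbsTopIII2015, Cor 3.7 (iv) p.88] -/
theorem model_forall_telecoreIncompatibleStmt_iff :
    (∀ θ : FiberSquare.BiAnabelianLift ((modelSetting p).restrict P fun _ h => h).gal,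
      Literature.AnabelianGeometry.AbsoluteAnabelian.AbsTopIII.BiAnabelianSetting.TelecoreIncompatibleStmt
        ((modelSetting p).restrict P fun _ h => h) θ) ↔ ∃ A : TFModel p, P A := by
  refine ⟨fun h => ?_, fun ⟨A, hA⟩ θ => model_of_telecoreIncompatibleStmt p P A hA θ⟩
  by_contra hne
  have hne' : ∀ A : TFModel p, ¬ P A := fun A hA => hne ⟨A, hA⟩
  obtain ⟨θ⟩ := nonempty_biAnabelianLift_of_forall_not p P hne'
  exact not_model_telecoreIncompatibleStmt_of_forall_not p P hne' θ (h θ)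

/-- **Exact range of F-0326's instance forms at the sub-models of the model**: the typed Cor 3.7 (iv)
holds at the `P`-sub-model for all lift data IFF `P` has an object.
[cite: MochizukiAbsTopIII2015, Cor 3.7 (iv) p.88] -/
theorem model_forall_cor_3_7_iv_iff :
    (∀ θ : FiberSquare.BiAnabelianLift ((modelSetting p).restrict P fun _ h => h).gal,
      Literature.AnabelianGeometry.AbsoluteAnabelian.AbsTopIII.BiAnabelianSetting.Cor_3_7_iv
        ((modelSetting p).restrict P fun _ h => h) θ) ↔ ∃ A : TFModel p, P A := by
  refine ⟨fun h => ?_, fun ⟨A, hA⟩ θ => model_of_cor_3_7_iv p P A hA θ⟩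
  by_contra hne
  have hne' : ∀ A : TFModel p, ¬ P A := fun A hA => hne ⟨A, hA⟩
  obtain ⟨θ⟩ := nonempty_biAnabelianLift_of_forall_not p P hne'
  exact not_model_telecoreIncompatibleStmt_of_forall_not p P hne' θ (h θ).2

end TFModel

end Literature.AnabelianGeometry.AbsoluteAnabelian.AbsTopIII

end
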